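import Literature.Computability.Complexity.Randomized
import Literature.Computability.Complexity.CodeFPArith
import Literature.Computability.Complexity.StackUnaryBits
import Literature.Computability.Cryptography.CoinBlockLaws
import Literature.Computability.Cryptography.OneWayFunctions
import Literature.Computability.Complexity.PairingMachines
import Literature.Computability.Complexity.TimeBoundsProofs
import HarnessLib

/-!
# Calling a PPT subroutine whose coin budget is only polynomially BOUNDED: guess the budget

Topic `Computability/Cryptography` (family `pqc`). A randomized algorithm `A : RandAlg` (Arora–Barak Def. 7.1)
comes with a coin budget `A.coinLen : ℕ → ℕ` of which "PPT" (`RandAlg.IsPPT`) only promises a polynomial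
BOUND; its success probability `A.pr` refers to coin strings of EXACTLY that length, and nothing relates
`A.run x r` for strings `r` of other lengths. A reduction that calls `A` as a subroutine (the `SIS′` oracle of
Micciancio–Regev's Thm. 5.9 / Thm. 5.23, `Literature.Computability.Cryptography.MicciancioRegev2007_gapCVP'_to_SIS'`)
cannot compute `A.coinLen`, so it GUESSES it: it reads a guess word `g` of `W` coins and a supply `u` of `R`
coins and runs `A` on the first `min (val g) R` coins of the supply (`callRun`). Over uniform coins this is a
FIXED probability kernel `x ↦ callLaw A W R x` (so an analysis written for an arbitrary oracle kernel applies
to it verbatim), and whenever `A.coinLen |x| ≤ R`, `A.coinLen |x| < 2^W` every event has probability at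
least `2^{−W}` times its probability under `A` itself (`le_toReal_callLaw`: the guess is right with
probability `2^{−W}`, and then the coins passed are uniform of the right length and independent of the
guess). The call is polynomial time in `(x, coins)` when `A` is (`callRun_codeFP`). The same device, inlined,
drives `SIS.sisSolver` (`SISFunctionSolver.lean`); here it is packaged once for reuse.

* `callRun A W R x r`, `callLaw A W R x` (definitions with bodies);
* `uniformVector_map_take` — the first `L ≤ R` coins of a uniform `R`-string are uniform;
* **`le_toReal_callLaw`** — `2^{−W} · A.pr id x E ≤ (callLaw A W R x)(E)`;
* **`callRun_codeFP`** — `CodeFP (pairE strE strE) strE (fun p => callRun A W R p.1 p.2)` for `A` PPT, uniformly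
  in `W R` given as unary fields: `CodeFP (pairE (pairE unE unE) (pairE strE strE)) strE …`.

All proved; no named fact.

## References

* S. Arora, B. Barak, *Computational Complexity: A Modern Approach*, CUP 2009, Def. 7.1 (coins as a uniform
  string of a length determined by the input length), §7.4.1 [AroraBarak2009].
* O. Goldreich, *Foundations of Cryptography I*, CUP 2001, §1.3.2 (PPT machines; invoking a PPT subroutine)
  [Goldreich2001].
* D. Micciancio, O. Regev, SIAM J. Comput. 37 (2007), Thm. 5.23 (proof: "using the oracle") [MicciancioRegev2007].
-/

noncomputable section

namespace Literature.Computability.Cryptography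

namespace GuessedCoinCall

open Literature.Computability.Complexity Literature.Computability.Complexity.CodeFP PMF MeasureTheory Finset
open scoped ENNReal

variable (A : RandAlg (List Bool) (List Bool)) (W R : ℕ)

/-- **One call with a guessed coin count**: the coins are `r = g ++ u ++ …` with a guess word `g = r[0, W)`
and a supply `u = r[W, W + R)`; `A` is run on input `x` with the first `min (val g) R` coins of the supply.
[cite: Goldreich2001, §1.3.2] -/
def callRun (x r : List Bool) : List Bool :=
  A.run x (((r.drop W).take R).take (min (bitsToNat (r.take W)) R))

/-- **The law of the call** on input `x` over uniform coins of length `W + R`: a fixed probability kernel.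
[cite: AroraBarak2009, Def. 7.1] -/
def callLaw (x : List Bool) : PMF (List Bool) :=
  (uniformOfFintype (List.Vector Bool (W + R))).map fun r => callRun A W R x r.toList

variable {A W R}

/-- `callRun` only reads the first `W + R` coins. [folklore] -/
theorem callRun_take (x r : List Bool) : callRun A W R x (r.take (W + R)) = callRun A W R x r := by
  have h1 : (r.take (W + R)).take W = r.take W := by
    rw [List.take_take, min_eq_left (Nat.le_add_right W R)]
  have h2 : ((r.take (W + R)).drop W).take R = (r.drop W).take R := by
    rw [List.drop_take, Nat.add_sub_cancel_left, List.take_take, min_self]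
  unfold callRun
  rw [h2, h1]

/-- A probability is finite. [folklore] -/
theorem toOuterMeasure_ne_top {α : Type*} (p : PMF α) (S : Set α) : p.toOuterMeasure S ≠ ⊤ :=
  ne_top_of_le_ne_top ENNReal.one_ne_top ((p.toOuterMeasure_mono (fun _ _ => Set.mem_univ _)).trans_eq
    ((p.toOuterMeasure_apply_eq_one_iff Set.univ).2 (Set.subset_univ _)))

/-- **The first `L ≤ R` coins of a uniform `R`-string are uniform.** [cite: AroraBarak2009, Def. 7.1] -/
theorem uniformVector_map_take {L R : ℕ} (h : L ≤ R) :
    (uniformOfFintype (List.Vector Bool R)).map (fun u => (vecSplit L R h u).1) = uniformOfFintype (List.Vector Bool L) := by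
  rw [show (fun u => (vecSplit L R h u).1) = Prod.fst ∘ vecSplit L R h from rfl,
    ← PMF.map_comp (vecSplit L R h) _ Prod.fst, uniformVector_map_vecSplit, uniformOfFintype_prod_eq_bind, PMF.map_bind]
  simp only [PMF.map_comp, Function.comp_def]
  have hc : ∀ a : List.Vector Bool L,
      (uniformOfFintype (List.Vector Bool (R - L))).map (fun _ => a) = PMF.pure a := fun a => PMF.map_const _ _
  simp only [hc, PMF.bind_pure]

/-- The probability of an event under `A` as the measure of a set of coin strings. [folklore] -/
theorem pr_id_eq (x : List Bool) (E : Set (List Bool)) :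
    A.pr id x E = ((uniformOfFintype (List.Vector Bool (A.coinLen x.length))).toOuterMeasure
      {u | A.run x u.toList ∈ E}).toReal := by
  rw [RandAlg.pr, RandAlg.outputPMF, PMF.toOuterMeasure_map_apply]
  rfl

/-- **The guess costs a factor `2^{−W}` and nothing else**: if `A.coinLen |x| ≤ R` and `A.coinLen |x| < 2^W`
then for every event `E`, `2^{−W} · Pr[A(x) ∈ E] ≤ Pr[callLaw A W R x ∈ E]`.
[cite: Goldreich2001, §1.3.2; AroraBarak2009, §7.4.1] -/
theorem le_toReal_callLaw {x : List Bool} (hR : A.coinLen x.length ≤ R) (hW : A.coinLen x.length < 2 ^ W)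
    (E : Set (List Bool)) :
    (2⁻¹ : ℝ) ^ W * A.pr id x E ≤ ((callLaw A W R x).toOuterMeasure E).toReal := by
  classical
  set L := A.coinLen x.length with hL
  set g₀ : List.Vector Bool W := ⟨natBits W L, length_natBits W L⟩ with hg₀
  -- the law of the pair (guess word, supply)
  have hsplit := uniformVector_map_vecSplit W (W + R) (Nat.le_add_right W R)
  -- the good coin strings: right guess and a successful run on the first `L` supply coins
  set G : Set (List.Vector Bool W × List.Vector Bool (W + R - W)) :=
    {p | p.1 = g₀ ∧ A.run x (p.2.toList.take L) ∈ E} with hG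
  have hsub : (vecSplit W (W + R) (Nat.le_add_right W R)) ⁻¹' G ⊆
      {r : List.Vector Bool (W + R) | callRun A W R x r.toList ∈ E} := by
    intro r hr
    simp only [Set.mem_preimage, hG, Set.mem_setOf_eq] at hr ⊢
    obtain ⟨h1, h2⟩ := hr
    have ht : r.toList.take W = natBits W L := by
      have := congrArg List.Vector.toList h1
      exact this
    have hd : (vecSplit W (W + R) (Nat.le_add_right W R) r).2.toList = r.toList.drop W := rfl
    rw [hd] at h2
    unfold callRun
    rw [ht, bitsToNat_natBits hW, min_eq_left hR, List.take_take, min_eq_left hR]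
    exact h2
  -- measure of `G` under the product law
  have hmeas : ((uniformOfFintype (List.Vector Bool (W + R))).toOuterMeasure
      ((vecSplit W (W + R) (Nat.le_add_right W R)) ⁻¹' G)).toReal = (2⁻¹ : ℝ) ^ W * A.pr id x E := by
    rw [← PMF.toOuterMeasure_map_apply, hsplit, uniformOfFintype_prod_eq_bind, PMF.toOuterMeasure_bind_apply]
    rw [tsum_eq_single g₀]
    · rw [PMF.toOuterMeasure_map_apply, uniformOfFintype_apply, ENNReal.toReal_mul]
      have hpre : Prod.mk g₀ ⁻¹' G = {u : List.Vector Bool (W + R - W) | A.run x (u.toList.take L) ∈ E} := by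
        ext u; simp [hG]
      rw [hpre]
      have hRL : L ≤ W + R - W := by omega
      have hev : {u : List.Vector Bool (W + R - W) | A.run x (u.toList.take L) ∈ E} =
          (fun u : List.Vector Bool (W + R - W) => (vecSplit L (W + R - W) hRL u).1) ⁻¹'
            {v : List.Vector Bool L | A.run x v.toList ∈ E} := by
        ext u; exact Iff.rfl
      rw [hev, ← PMF.toOuterMeasure_map_apply, uniformVector_map_take hRL, pr_id_eq]
      congr 1
      rw [card_vector, Fintype.card_bool, Nat.cast_pow, ENNReal.toReal_inv, ENNReal.toReal_pow, inv_pow]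
      norm_num
    · intro g hg
      rw [PMF.toOuterMeasure_map_apply]
      have hpre : Prod.mk g ⁻¹' G = ∅ := by
        ext u; simp [hG, hg]
      rw [hpre, measure_empty, mul_zero]
  rw [callLaw, PMF.toOuterMeasure_map_apply, ← hmeas]
  exact ENNReal.toReal_mono (toOuterMeasure_ne_top _ _)
    (measure_mono (μ := (uniformOfFintype (List.Vector Bool (W + R))).toOuterMeasure) hsub)

/-! ### Polynomial time -/

/-- **The call is polynomial time in `(x, coins)`, uniformly in unary `(W, R)`**, when `A` is PPT.
[cite: AroraBarak2009, §1.3 (composition) and Def. 7.1] -/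
theorem callRun_codeFP (hA : IsPPT A id) :
    CodeFP (pairE (pairE unE unE) (pairE strE strE)) strE (fun p => callRun A p.1.1 p.1.2 p.2.1 p.2.2) := by
  -- the run of `A` on codes
  have hrun : CodeFP (pairE strE strE) strE (Function.uncurry A.run) := by
    exact of_fn (Function.uncurry A.run ∘ boolUnpair) (PolyTimeComputable.comp_holds hA.1 polyTimeComputable_boolUnpair)
      fun q => by simp [pairE, strE, Function.uncurry]
  have hW : CodeFP (pairE (pairE unE unE) (pairE strE strE)) unE (fun p => p.1.1) := (fst _ _).fst'
  have hR : CodeFP (pairE (pairE unE unE) (pairE strE strE)) unE (fun p => p.1.2) := (fst _ _).snd'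
  have hx : CodeFP (pairE (pairE unE unE) (pairE strE strE)) strE (fun p => p.2.1) := (snd _ _).fst'
  have hr : CodeFP (pairE (pairE unE unE) (pairE strE strE)) strE (fun p => p.2.2) := (snd _ _).snd'
  -- the guess word and its value, capped at `R` (unary)
  have hg : CodeFP (pairE (pairE unE unE) (pairE strE strE)) strE (fun p => p.2.2.take p.1.1) :=
    strTake.comp (hW.pair hr)
  have hv : CodeFP (pairE (pairE unE unE) (pairE strE strE)) unE (fun p => min (bitsToNat (p.2.2.take p.1.1)) p.1.2) :=
    unOfNatMin.comp (hR.pair (strVal.comp hg))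
  -- the supply and the coins passed
  have hu : CodeFP (pairE (pairE unE unE) (pairE strE strE)) strE (fun p => (p.2.2.drop p.1.1).take p.1.2) :=
    strTake.comp (hR.pair (strDrop.comp (hW.pair hr)))
  have hc : CodeFP (pairE (pairE unE unE) (pairE strE strE)) strE
      (fun p => ((p.2.2.drop p.1.1).take p.1.2).take (min (bitsToNat (p.2.2.take p.1.1)) p.1.2)) :=
    strTake.comp (hv.pair hu)
  exact (hrun.comp (hx.pair hc)).congr fun p => rfl

end GuessedCoinCall

end Literature.Computability.Cryptography

end
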